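import Summits.Ventures.PercRepro2.CaseOneStarCertT1
import Summits.Ventures.PercRepro2.CaseOneGadgetUWA1OBlockII0
import Summits.Ventures.PercRepro2.CaseOneGadgetUWA1OBlockII1
import Summits.Ventures.PercRepro2.CaseOneGadgetUWA1OBlockII2
import Summits.Ventures.PercRepro2.CaseOneGadgetUWA1OBlockII3
import Summits.Ventures.PercRepro2.CaseOneGadgetUWA1OBlockII4
import Summits.Ventures.PercRepro2.CaseOneGadgetUWA1OBlockII5
import Summits.Ventures.PercRepro2.CaseOneGadgetUWA1OBlockII6
import Summits.Ventures.PercRepro2.CaseOneGadgetUWA1OBlockII7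
import Summits.Ventures.PercRepro2.CaseOneGadgetUWA1OBlockII8
import Summits.Ventures.PercRepro2.CaseOneGadgetUWA1OBlockII9
import Summits.Ventures.PercRepro2.CaseOneGadgetUWA1OBlockII10
import Summits.Ventures.PercRepro2.CaseOneGadgetUWA1OBlockII11
import Summits.Ventures.PercRepro2.CaseOneGadgetUWA1OBlockII12
import Summits.Ventures.PercRepro2.CaseOneGadgetUWA1OBlockII13
import Summits.Ventures.PercRepro2.CaseOneGadgetUWA1OBlockII14

/-!
# The gadget `u ~ {w, a₁, o}`, `w ~ {u, a₂, b}` (uwa1o): the cell certificates of `iiAO5` (part 33d)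
(blind cell PercRepro2, p1 g34; the fourth gadget anchor of the six-form calculus — all six forms of the uwa1o gadget
as plain SFacts-cone certificate chains, generated by mining/p1/g34/uwa1o/genu.py = p1 g33's gent_uwa1.py / g25's
geno.py re-targeted; P1-G33 §6–§6″, P1-G34)

Each `eBAOII ijk kl` is a nonnegative combination of `(pairwise atom) × (cell)` and cubic cell monomials — or, for the degree-4 ones, `M × eBAOII ijk kl` (`M = Σ cᵢ` the total cell mass) is a nonnegative combination of `(atom) × (cell) × (cell)` and quartic cell monomials, then `SFacts.nonneg_of_sum_mul` (`CaseOneStarCertT1`) — exact LP certificates (kit j318477, every certificate re-verified exactly; data/p1/g33/gcerts_ii_uwa1o.json, form `ii`), here as exact `linear_combination`s over `SFacts` (the rational coefficients cleared by their common denominator). -/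

namespace Summit.Ventures.PercRepro2

namespace CaseOne

section CertAOII33d
variable {R : Type*} [Field R] [LinearOrder R] [IsStrictOrderedRing R]

set_option maxHeartbeats 0 in
/-- `eBAOII22323 ≥ 0`: the combination is identically zero (`ring`). -/
lemma eBAOII22323_nonneg (m : SCells R) (_hf : SFacts m) : 0 ≤ eBAOII22323 m := by
  have h : eBAOII22323 m = 0 := by
    unfold eBAOII22323 cBAOII00123 cBAOII00223 cBAOII01023 cBAOII01123 cBAOII01223 cBAOII01323 cBAOII02023 cBAOII02123 cBAOII02223 cBAOII02323 cBAOII10023 cBAOII10123 cBAOII10223 cBAOII10323 cBAOII11023 cBAOII11123 cBAOII11223 cBAOII11323 cBAOII12023 cBAOII12123 cBAOII12223 cBAOII12323 cBAOII20023 cBAOII20123 cBAOII20223 cBAOII20323 cBAOII21023 cBAOII21123 cBAOII21223 cBAOII21323 cBAOII22023 cBAOII22123 cBAOII22223 cBAOII22323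
    ring
  linarith [h]

set_option maxHeartbeats 0 in
/-- `eBAOII22330 ≥ 0`: the combination is identically zero (`ring`). -/
lemma eBAOII22330_nonneg (m : SCells R) (_hf : SFacts m) : 0 ≤ eBAOII22330 m := by
  have h : eBAOII22330 m = 0 := by
    unfold eBAOII22330 cBAOII00130 cBAOII00230 cBAOII01030 cBAOII01130 cBAOII01230 cBAOII01330 cBAOII02030 cBAOII02130 cBAOII02230 cBAOII02330 cBAOII10130 cBAOII10230 cBAOII10330 cBAOII11030 cBAOII11130 cBAOII11230 cBAOII11330 cBAOII12030 cBAOII12130 cBAOII12230 cBAOII12330 cBAOII20130 cBAOII20230 cBAOII20330 cBAOII21030 cBAOII21130 cBAOII21230 cBAOII21330 cBAOII22030 cBAOII22130 cBAOII22230 cBAOII22330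
    ring
  linarith [h]

end CertAOII33d

end CaseOne

end Summit.Ventures.PercRepro2
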